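import Summits.QuantumFields.BalabanUV.Beta.FP.BlockAveragedRemainderAxial

/-!
# Road FP (binder row D1), row H′2-IR — IR-Q ∕ IR-1 SUPPLEMENT: DIFFERENCES OF `R^Q = A·G_C·Aᵀ` IN THE SOURCE VARIABLE —
# `|R^Q((x,μ),(y+e_i,ν)) − R^Q((x,μ),(y,ν))| ≤ C·n⁻³` from the leg's difference letter at the SECOND leg (no cancellation, no symmetry of `R^Q` used);
# generic and at `axialAvg` (the `P^{BF}` instance follows in `FP/BlockAveragedPropagatorWindow`; our bookkeeping)

HONEST DEPENDENCY (page 1, mandatory): continuum YM on T⁴ ⇐ BetaPertH ∧ nine spine estimates (0/9 proved); BetaPertH ⇐ (D1) ∧ (D4) ∧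
CAP+tail; G-an2-4 gates asym, D1 and NE2/3/4.  HONEST FRAMING (cell contract, verbatim): «discharging `BetaPertH` makes Bałaban's UV
stability UNCONDITIONAL — a real constructive-QFT result; it is NOT the continuum limit and NOT the Clay problem.»  THIS MODULE is
[folklore]∕our bookkeeping over this lineage's IR-Q PART A∕B (`FP/BlockAveragedRemainder`, `FP/BlockAveragedRemainderAxial`) and leaf-05-g9's
`FP/LatticeConvolutionBounds`, BY NAME; it cites nothing, declares no `def`, mints no `def … : Prop`, has 0 `sorry`; every kernel is ARBITRARY with
displayed letters (the `P^{BF} := Re PinfKer` instance, modulo IR-2, is in `FP/BlockAveragedPropagatorWindow`).  WHY: the x-differences (T1) of PART A∕B∕C difference the FIRST leg; without the symmetry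
`R^Q((x,μ),(y,ν)) = R^Q((y,ν),(x,μ))` (which needs (K4) and `G_C` symmetric — not in the tree) the SOURCE-variable difference is a separate letter:
it differences the SECOND leg inside the multiplier, where a degree-5 kernel reproduces the degree-3 difference profile directly (no cancellation).
It discharges NOTHING of row H′2-IR ∕ `ρ_a` ∕ `hasym` ∕ D1 ∕ `BetaPertH`; NEVER «G-an2-4 closed»; NOT (CONV-C), NOT D1, NOT the continuum limit, NOT Clay.

ABSOLUTE RULE (cell charter, verbatim): «No internally-minted statement may enter as a cited fact. Every hypothesis is either
kernel-proved in this package or a verbatim quotation of a PUBLISHED theorem with page reference. The manuscript(s) under audit are NOT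
citable for their own disputed steps — they are the thing under adjudication; programme-internal (2001/route/tribunal) claims are never
citable.»

CONTENT. §1 generic: `mult_sub_mult_le` (`|W′ α u − W α u| ≤ |ι|·1296·κ·a′∕(‖u−w‖∞+1)³` from (G-poly) and the second legs' difference letter
`|b′ β v − b β v| ≤ a′∕(‖v−w‖∞+1)³`), `abs_rem_sub_right_le` (`|R′ − R| ≤ |ι|·162·a₀·dK`); §2 at `axialAvg`: `abs_remQ_sub_right_le`
(`≤ 4·162·(36·531442·C₀∕n²)·(4·1296·κ·(216·531442·C₁∕n³))`, i.e. `≍ n⁻³` at `κ ≍ n²`).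
Unit `b2b-balaban-gan24-formalise-leaf-04` (gen 40; cross-lane idle G-an2-4 swarm leaf seat on road FP), 2026-08-20; rows IR-Q (l.236) ∕ IR-1 (l.212) of `LEAVES-FP.md`.
-/

namespace Summit.QuantumFields.BalabanUV.Beta.FP.BlockAveragedRemainderSource

open Finset
open scoped BigOperators
open Literature.MathematicalPhysics.QuantumFieldTheory.Balaban1983to89.Beta
open Literature.MathematicalPhysics.QuantumFieldTheory.Balaban1983to89.Beta.DyadicShell (Pt supNorm)
open Literature.MathematicalPhysics.QuantumFieldTheory.Balaban1983to89.Beta.GradedBubbles (supNorm_neg)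
open Literature.MathematicalPhysics.QuantumFieldTheory.Balaban1983to89.Beta.AxialComposition (axialAvg)
open Literature.MathematicalPhysics.QuantumFieldTheory.LatticeForm (quo)
open Summit.QuantumFields.BalabanUV.Beta.FP.LatticeConvolutionBounds (nonneg_of_abs_le_div tsum_kernel_profile_le exp_neg_supNorm_le_div_pow)
open Summit.QuantumFields.BalabanUV.Beta.FP.BlockAveragedKernel (letter_nonneg_of_le)
open Summit.QuantumFields.BalabanUV.Beta.FP.BlockAveragedRemainder (abs_tsum_sum_mul_le mult_sub_delta_bound abs_mult_le)
open Summit.QuantumFields.BalabanUV.Beta.FP.BlockAveragedRemainderAxial (leg_letter leg_diff_letter leg_osc_letter abs_multQ_le)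

noncomputable section

variable {ι : Type*} [Fintype ι]

/-! ## §1 Generic: differencing the second leg inside the multiplier -/

/-- [folklore] **THE MULTIPLIER's DIFFERENCE IN THE SECOND LEG**: if the second legs `b′, b` differ by a degree-3 profile
(`|b′ β v − b β v| ≤ a′∕(‖v−w‖∞+1)³`) and `G` is 5-polynomially local, then (given summability of both multiplier series)
`|Σ'_v Σ_β G α β u v·b′ β v − Σ'_v Σ_β G α β u v·b β v| ≤ |ι|·1296·κ·a′∕(‖u−w‖∞+1)³` — no cancellation needed. -/
theorem mult_sub_mult_le {G : ι → ι → Pt → Pt → ℝ} {b b' : ι → Pt → ℝ} {κ a' : ℝ} {w : Pt}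
    (hG : ∀ α β u v, |G α β u v| ≤ κ / ((supNorm (u - v) : ℝ) + 1) ^ 5)
    (hdiff : ∀ β v, |b' β v - b β v| ≤ a' / ((supNorm (v - w) : ℝ) + 1) ^ 3)
    (α : ι) (u : Pt)
    (hb : Summable (fun v => ∑ β, G α β u v * b β v)) (hb' : Summable (fun v => ∑ β, G α β u v * b' β v)) :
    |∑' v, ∑ β, G α β u v * b' β v - ∑' v, ∑ β, G α β u v * b β v|
      ≤ (Fintype.card ι : ℝ) * 1296 * κ * a' / ((supNorm (u - w) : ℝ) + 1) ^ 3 := by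
  have hG' : ∀ β v, |G α β u v| ≤ κ / ((supNorm (v - u) : ℝ) + 1) ^ 5 := fun β v => by
    rw [← supNorm_neg, neg_sub]; exact hG α β u v
  have hβ : ∀ β, Summable (fun v => G α β u v * (b' β v - b β v))
      ∧ |∑' v, G α β u v * (b' β v - b β v)| ≤ κ * a' * (162 * (2 / ((supNorm (u - w) : ℝ) + 2)) ^ 3) :=
    fun β => tsum_kernel_profile_le u w (le_refl 5) (by norm_num : 3 ≤ 5) (hG' β) (hdiff β)
  rw [← hb'.tsum_sub hb]
  have e : (fun v => ∑ β, G α β u v * b' β v - ∑ β, G α β u v * b β v) = fun v => ∑ β, G α β u v * (b' β v - b β v) := by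
    funext v; rw [← Finset.sum_sub_distrib]; refine Finset.sum_congr rfl fun β _ => ?_; ring
  rw [e, Summable.tsum_finsetSum fun β _ => (hβ β).1]
  refine (Finset.abs_sum_le_sum_abs _ _).trans ?_
  have hκ : 0 ≤ κ := nonneg_of_abs_le_div (f := fun v => G α α u v) (p := u) (a := 5) u (hG' α u)
  have ha' : 0 ≤ a' := nonneg_of_abs_le_div (f := fun v => b' α v - b α v) (p := w) (a := 3) w (hdiff α w)
  have key : κ * a' * (162 * (2 / ((supNorm (u - w) : ℝ) + 2)) ^ 3) ≤ 1296 * κ * a' / ((supNorm (u - w) : ℝ) + 1) ^ 3 := by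
    rw [div_pow, show (2 : ℝ) ^ 3 = 8 by norm_num]
    have k1 : 162 * (8 / (((supNorm (u - w) : ℝ) + 2) ^ 3)) ≤ 1296 / ((supNorm (u - w) : ℝ) + 1) ^ 3 := by
      rw [mul_div_assoc', show (162 : ℝ) * 8 = 1296 by norm_num]
      apply div_le_div_of_nonneg_left (by norm_num) (by positivity)
      gcongr; norm_num
    calc κ * a' * (162 * (8 / ((supNorm (u - w) : ℝ) + 2) ^ 3))
        ≤ κ * a' * (1296 / ((supNorm (u - w) : ℝ) + 1) ^ 3) := mul_le_mul_of_nonneg_left k1 (mul_nonneg hκ ha')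
      _ = 1296 * κ * a' / ((supNorm (u - w) : ℝ) + 1) ^ 3 := by ring
  calc ∑ β, |∑' v, G α β u v * (b' β v - b β v)|
      ≤ ∑ _β : ι, 1296 * κ * a' / ((supNorm (u - w) : ℝ) + 1) ^ 3 := Finset.sum_le_sum fun β _ => ((hβ β).2).trans key
    _ = (Fintype.card ι : ℝ) * 1296 * κ * a' / ((supNorm (u - w) : ℝ) + 1) ^ 3 := by
        rw [Finset.sum_const, nsmul_eq_mul, Finset.card_univ]; ring

/-- [folklore] **THE REMAINDER's DIFFERENCE IN THE SOURCE VARIABLE**: a degree-2 leg letter at the first leg, degree-3 letters for the two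
multipliers (summability) and a degree-3 letter for their DIFFERENCE (`mult_sub_mult_le`) give `|R′ − R| ≤ |ι|·162·a₀·dK`. -/
theorem abs_rem_sub_right_le {a W W' : ι → Pt → ℝ} {a₀ K K' dK : ℝ} {p w w' w₀ : Pt}
    (ha : ∀ α u, |a α u| ≤ a₀ / ((supNorm (u - p) : ℝ) + 1) ^ 2)
    (hW : ∀ α u, |W α u| ≤ K / ((supNorm (u - w) : ℝ) + 1) ^ 3)
    (hW' : ∀ α u, |W' α u| ≤ K' / ((supNorm (u - w') : ℝ) + 1) ^ 3)
    (hd : ∀ α u, |W' α u - W α u| ≤ dK / ((supNorm (u - w₀) : ℝ) + 1) ^ 3) :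
    |∑' u, ∑ α, a α u * W' α u - ∑' u, ∑ α, a α u * W α u| ≤ (Fintype.card ι : ℝ) * 162 * a₀ * dK := by
  have hS := (abs_tsum_sum_mul_le (s := 2) (t := 3) (by norm_num) p w ha hW).1
  have hS' := (abs_tsum_sum_mul_le (s := 2) (t := 3) (by norm_num) p w' ha hW').1
  rw [← hS'.tsum_sub hS]
  have e : (fun u => ∑ α, a α u * W' α u - ∑ α, a α u * W α u) = fun u => ∑ α, a α u * (W' α u - W α u) := by
    funext u; rw [← Finset.sum_sub_distrib]; refine Finset.sum_congr rfl fun α _ => ?_; ring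
  rw [e]
  exact (abs_tsum_sum_mul_le (W := fun α u => W' α u - W α u) (s := 2) (t := 3) (by norm_num) p w₀ ha hd).2

/-! ## §2 At the axial block average -/

section Axial

variable {P : Fin 4 → Fin 4 → Pt → ℝ} {C₀ C₁ κ : ℝ} {G : Fin 4 → Fin 4 → Pt → Pt → ℝ} {n : ℕ}

/-- **(T1, SOURCE VARIABLE) AT `axialAvg`** [our bookkeeping]: under (P0), (P1), (G-poly κ), (G-inv),
`|R^Q((x,μ),(y+e_i,ν)) − R^Q((x,μ),(y,ν))| ≤ 4·162·(36·531442·C₀∕n²)·(4·1296·κ·(216·531442·C₁∕n³))` (`≍ n⁻³` at `κ ≍ n²`). -/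
theorem abs_remQ_sub_right_le
    (hP0 : ∀ μ α z, |P μ α z| ≤ C₀ / ((supNorm z : ℝ) + 1) ^ 2)
    (hP1 : ∀ μ α (i : Fin 4) z, |P μ α (z + Pi.single i 1) - P μ α z| ≤ C₁ / ((supNorm z : ℝ) + 1) ^ 3)
    (hn : 1 ≤ n)
    (hG : ∀ α β u v, |G α β u v| ≤ κ / ((supNorm (u - v) : ℝ) + 1) ^ 5)
    (hinv : ∀ (w : Pt) (ν α : Fin 4) (u : Pt), HasSum
      (fun v => ∑ β, G α β u v * axialAvg n ν (fun y' => axialAvg n β (fun t => P ν β (y' - t)) v) w)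
      (if u = w ∧ α = ν then 1 else 0))
    (μ ν : Fin 4) (x y : Pt) (i : Fin 4) :
    |(∑' u, ∑ α, axialAvg n α (fun v => P μ α (x - v)) u
          * ∑' v, ∑ β, G α β u v * axialAvg n β (fun t => P ν β (y + Pi.single i 1 - t)) v)
      - (∑' u, ∑ α, axialAvg n α (fun v => P μ α (x - v)) u
          * ∑' v, ∑ β, G α β u v * axialAvg n β (fun t => P ν β (y - t)) v)|
        ≤ (Fintype.card (Fin 4) : ℝ) * 162 * (36 * 531442 * C₀ / (n : ℝ) ^ 2)
            * ((Fintype.card (Fin 4) : ℝ) * 1296 * κ * (216 * 531442 * C₁ / (n : ℝ) ^ 3)) := by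
  -- the two multipliers: letters by PART B's (W) at their own blocks, summability by the cancellation lemma (explicit legs — no
  -- higher-order unification)
  have hW : ∀ α u, |∑' v, ∑ β, G α β u v * axialAvg n β (fun t => P ν β (y - t)) v|
      ≤ ((Fintype.card (Fin 4) : ℝ) * 1296 * κ * (13824 * 531442 * C₁ / (n : ℝ) ^ 2) + 1)
          / ((supNorm (u - quo n y) : ℝ) + 1) ^ 3 :=
    fun α u => abs_multQ_le hP1 hn hG hinv ν y α u
  have hW' : ∀ α u, |∑' v, ∑ β, G α β u v * axialAvg n β (fun t => P ν β (y + Pi.single i 1 - t)) v|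
      ≤ ((Fintype.card (Fin 4) : ℝ) * 1296 * κ * (13824 * 531442 * C₁ / (n : ℝ) ^ 2) + 1)
          / ((supNorm (u - quo n (y + Pi.single i 1)) : ℝ) + 1) ^ 3 :=
    fun α u => abs_multQ_le hP1 hn hG hinv ν (y + Pi.single i 1) α u
  have hSgen : ∀ (y₀ : Pt) (α : Fin 4) (u : Pt), Summable (fun v => ∑ β, G α β u v * axialAvg n β (fun t => P ν β (y₀ - t)) v) :=
    fun y₀ α u => (mult_sub_delta_bound (b := fun β v => axialAvg n β (fun t => P ν β (y₀ - t)) v)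
      (c := fun β v => axialAvg n ν (fun y' => axialAvg n β (fun t => P ν β (y' - t)) v) (quo n y₀))
      hG (fun β v => leg_osc_letter hP1 hn ν y₀ β v) (hinv (quo n y₀) ν) α u).1
  have hS : ∀ α u, Summable (fun v => ∑ β, G α β u v * axialAvg n β (fun t => P ν β (y - t)) v) := hSgen y
  have hS' : ∀ α u, Summable (fun v => ∑ β, G α β u v * axialAvg n β (fun t => P ν β (y + Pi.single i 1 - t)) v) :=
    hSgen (y + Pi.single i 1)
  -- the difference of the multipliers: the second legs differ by (A1) centred at `quo n y`
  have hd : ∀ α u, |(∑' v, ∑ β, G α β u v * axialAvg n β (fun t => P ν β (y + Pi.single i 1 - t)) v)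
      - ∑' v, ∑ β, G α β u v * axialAvg n β (fun t => P ν β (y - t)) v|
      ≤ (Fintype.card (Fin 4) : ℝ) * 1296 * κ * (216 * 531442 * C₁ / (n : ℝ) ^ 3) / ((supNorm (u - quo n y) : ℝ) + 1) ^ 3 :=
    fun α u => mult_sub_mult_le (b := fun β v => axialAvg n β (fun t => P ν β (y - t)) v)
      (b' := fun β v => axialAvg n β (fun t => P ν β (y + Pi.single i 1 - t)) v) (w := quo n y)
      hG (fun β v => leg_diff_letter hP1 hn ν y i β v) α u (hS α u) (hS' α u)
  exact abs_rem_sub_right_le (a := fun α u => axialAvg n α (fun v => P μ α (x - v)) u)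
    (W := fun α u => ∑' v, ∑ β, G α β u v * axialAvg n β (fun t => P ν β (y - t)) v)
    (W' := fun α u => ∑' v, ∑ β, G α β u v * axialAvg n β (fun t => P ν β (y + Pi.single i 1 - t)) v)
    (p := quo n x) (w := quo n y) (w' := quo n (y + Pi.single i 1)) (w₀ := quo n y)
    (fun α u => leg_letter hP0 hn μ x α u) hW hW' hd

end Axial

end

end Summit.QuantumFields.BalabanUV.Beta.FP.BlockAveragedRemainderSource
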